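import Summits.KontsevichZagierPeriods.Zeta5Search.WedgeDictionaryLevelDescentWeights
import HarnessLib

/-!
# Level descent (LD@N) — the WEIGHT SIDE of the inductive proof, II: step lemmas, (L3) cross-contiguity, the two-term branch, the face value (PROOFS)

HONEST FRAMING: systematic search; no irrationality claim unless certified.

OUR work (Summit side; planner gen-1 g7, 2026-08-20; memo `pub-zeta5-gen-1/D2-LD-PROOF-g7.md` §3–§5b).  Proves BY NAME the three statements of
`WedgeDictionaryLevelDescentWeights`: `ldW_cross : ldW_cross_stmt` ((L3): the truncated symmetric weights `ldW b m` satisfy the cross-contiguity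
relation of the wedges termwise in `m` — interior `m` by the ratio identity `ldStep2`/`ldStep7`, the edges `m = b₂`, `m = b₇`, `m = σ−N−1` and the
vanishing-product cases separately), `ldW_twoTerm : ldW_twoTerm_stmt` (row `b₇ = 0`), `ldW_face : ldW_face_stmt` (face `b₁ + b₂ = N`: only `m = b₇`
survives, with the value `faceValue b`).  Everything is an identity between rational numbers (`linear_combination` over the step lemmas, `omega` for the
support bookkeeping).  What this is NOT: the level-descent identity itself (that needs (L1), (L2), the series-side face value `coeffU_faceExt_stmt` and the
induction on the level), or a statement about irrationality.
-/

open Finset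

namespace Summit.KontsevichZagierPeriods.Zeta5Search.WedgeDictionary

open Summit.KontsevichZagierPeriods.Zeta5Search.DualSeries

/-! ## gen-1 g7: kernel proof of (L3) — the truncated weights satisfy the cross-contiguity relation termwise -/

/-- `facQ (z+1) = (z+1)·facQ z` for `z ≥ 0`. -/
theorem facQ_succ {z : ℤ} (hz : 0 ≤ z) : facQ (z + 1) = ((z : ℚ) + 1) * facQ z := by
  unfold facQ
  rw [show (z + 1).toNat = z.toNat + 1 by omega, Nat.factorial_succ]
  push_cast
  rw [show ((z.toNat : ℕ) : ℚ) = (z : ℚ) by exact_mod_cast Int.toNat_of_nonneg hz]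

/-- Slot 0 of `b` with slot 2 lowered by one is `b 0`. -/
theorem low2_0 (b : ℕ → ℤ) : Function.update b 2 (b 2 - 1) 0 = b 0 := Function.update_of_ne (by decide) _ _
/-- Slot 1 of `b` with slot 2 lowered by one is `b 1`. -/
theorem low2_1 (b : ℕ → ℤ) : Function.update b 2 (b 2 - 1) 1 = b 1 := Function.update_of_ne (by decide) _ _
/-- Slot 2 of `b` with slot 2 lowered by one is `b 2 − 1`. -/
theorem low2_2 (b : ℕ → ℤ) : Function.update b 2 (b 2 - 1) 2 = b 2 - 1 := Function.update_self _ _ _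
/-- Slot 3 of `b` with slot 2 lowered by one is `b 3`. -/
theorem low2_3 (b : ℕ → ℤ) : Function.update b 2 (b 2 - 1) 3 = b 3 := Function.update_of_ne (by decide) _ _
/-- Slot 4 of `b` with slot 2 lowered by one is `b 4`. -/
theorem low2_4 (b : ℕ → ℤ) : Function.update b 2 (b 2 - 1) 4 = b 4 := Function.update_of_ne (by decide) _ _
/-- Slot 5 of `b` with slot 2 lowered by one is `b 5`. -/
theorem low2_5 (b : ℕ → ℤ) : Function.update b 2 (b 2 - 1) 5 = b 5 := Function.update_of_ne (by decide) _ _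
/-- Slot 6 of `b` with slot 2 lowered by one is `b 6`. -/
theorem low2_6 (b : ℕ → ℤ) : Function.update b 2 (b 2 - 1) 6 = b 6 := Function.update_of_ne (by decide) _ _
/-- Slot 7 of `b` with slot 2 lowered by one is `b 7`. -/
theorem low2_7 (b : ℕ → ℤ) : Function.update b 2 (b 2 - 1) 7 = b 7 := Function.update_of_ne (by decide) _ _
/-- Slot 0 of `b` with slot 7 lowered by one is `b 0`. -/
theorem low7_0 (b : ℕ → ℤ) : Function.update b 7 (b 7 - 1) 0 = b 0 := Function.update_of_ne (by decide) _ _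
/-- Slot 1 of `b` with slot 7 lowered by one is `b 1`. -/
theorem low7_1 (b : ℕ → ℤ) : Function.update b 7 (b 7 - 1) 1 = b 1 := Function.update_of_ne (by decide) _ _
/-- Slot 2 of `b` with slot 7 lowered by one is `b 2`. -/
theorem low7_2 (b : ℕ → ℤ) : Function.update b 7 (b 7 - 1) 2 = b 2 := Function.update_of_ne (by decide) _ _
/-- Slot 3 of `b` with slot 7 lowered by one is `b 3`. -/
theorem low7_3 (b : ℕ → ℤ) : Function.update b 7 (b 7 - 1) 3 = b 3 := Function.update_of_ne (by decide) _ _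
/-- Slot 4 of `b` with slot 7 lowered by one is `b 4`. -/
theorem low7_4 (b : ℕ → ℤ) : Function.update b 7 (b 7 - 1) 4 = b 4 := Function.update_of_ne (by decide) _ _
/-- Slot 5 of `b` with slot 7 lowered by one is `b 5`. -/
theorem low7_5 (b : ℕ → ℤ) : Function.update b 7 (b 7 - 1) 5 = b 5 := Function.update_of_ne (by decide) _ _
/-- Slot 6 of `b` with slot 7 lowered by one is `b 6`. -/
theorem low7_6 (b : ℕ → ℤ) : Function.update b 7 (b 7 - 1) 6 = b 6 := Function.update_of_ne (by decide) _ _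
/-- Slot 7 of `b` with slot 7 lowered by one is `b 7 − 1`. -/
theorem low7_7 (b : ℕ → ℤ) : Function.update b 7 (b 7 - 1) 7 = b 7 - 1 := Function.update_self _ _ _

/-- Lowering slot 2 by one raises `d` by one. -/
theorem dOf_low2 (b : ℕ → ℤ) : dOf (Function.update b 2 (b 2 - 1)) = dOf b + 1 := by
  simp only [dOf, sum_range_succ, sum_range_zero, Nat.reduceAdd, low2_0, low2_1, low2_2, low2_3, low2_4, low2_5, low2_6, low2_7]; ring

/-- Lowering slot 7 by one raises `d` by one. -/
theorem dOf_low7 (b : ℕ → ℤ) : dOf (Function.update b 7 (b 7 - 1)) = dOf b + 1 := by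
  simp only [dOf, sum_range_succ, sum_range_zero, Nat.reduceAdd, low7_0, low7_1, low7_2, low7_3, low7_4, low7_5, low7_6, low7_7]; ring

/-- Numerator of the symmetric weight. -/
def ldNum (b : ℕ → ℤ) (m : ℤ) : ℚ :=
  facQ (dOf b) * facQ (b 1) * facQ (b 2) * facQ (b 7) *
    (facQ (b 0 - b 3 - m) * facQ (b 0 - b 4 - m) * facQ (b 0 - b 5 - m) * facQ (b 0 - b 6 - m))

/-- Denominator of the symmetric weight. -/
def ldDen (b : ℕ → ℤ) (m : ℤ) : ℚ :=
  facQ (b 1 - m) * facQ (b 2 - m) * facQ (b 7 - m) *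
    (facQ (b 0 - b 1 - b 3) * facQ (b 0 - b 1 - b 4) * facQ (b 0 - b 1 - b 5) * facQ (b 0 - b 1 - b 6)) *
    (facQ (b 0 - b 2 - b 3) * facQ (b 0 - b 2 - b 4) * facQ (b 0 - b 2 - b 5) * facQ (b 0 - b 2 - b 6)) *
    (facQ (b 0 - b 7 - b 3) * facQ (b 0 - b 7 - b 4) * facQ (b 0 - b 7 - b 5) * facQ (b 0 - b 7 - b 6)) *
    facQ m * facQ (2 * b 0 - sumB b - m) * facQ (b 0 + m - sigmaT b)

/-- The denominator of the symmetric weight never vanishes. -/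
theorem ldDen_ne_zero (b : ℕ → ℤ) (m : ℤ) : ldDen b m ≠ 0 := by
  simp [ldDen, facQ, Nat.factorial_ne_zero]

/-- The symmetric weight as `2(−1)^{m+ΣB}·ldNum/ldDen`. -/
theorem ldWeightSym_eq (b : ℕ → ℤ) (m : ℤ) :
    ldWeightSym b m = 2 * (-1 : ℚ) ^ (m + sumB b) * ldNum b m / ldDen b m := by
  simp only [ldWeightSym, ldNum, ldDen, Icc_three_six]
  simp only [prod_insert, mem_insert, mem_singleton, prod_singleton, Nat.reduceEqDiff, or_self,
    not_false_eq_true]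
  ring

/-- Step lemma, slot 2 lowered: `b₂·∏_{j∈B}(c₂ⱼ+1)·(N+m−σ+1)·Ω(b−e₂;m) = (d+1)(b₂−m)·Ω(b;m)`. -/
theorem ldStep2 (b : ℕ → ℤ) (m : ℤ) (hb2 : 1 ≤ b 2) (hm : m + 1 ≤ b 2)
    (h3 : 0 ≤ b 0 - b 2 - b 3) (h4 : 0 ≤ b 0 - b 2 - b 4) (h5 : 0 ≤ b 0 - b 2 - b 5) (h6 : 0 ≤ b 0 - b 2 - b 6)
    (hd : 0 ≤ dOf b) (hσ : 0 ≤ b 0 + m - (b 1 + b 2 + b 7)) :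
    (b 2 : ℚ) * (((b 0 : ℚ) - b 2 - b 3 + 1) * ((b 0 : ℚ) - b 2 - b 4 + 1) * ((b 0 : ℚ) - b 2 - b 5 + 1) *
        ((b 0 : ℚ) - b 2 - b 6 + 1)) * ((b 0 : ℚ) + m - (b 1 + b 2 + b 7) + 1) *
        ldWeightSym (Function.update b 2 (b 2 - 1)) m =
      ((dOf b : ℚ) + 1) * ((b 2 : ℚ) - m) * ldWeightSym b m := by
  rw [ldWeightSym_eq, ldWeightSym_eq, mul_div_assoc', mul_div_assoc',
    div_eq_div_iff (ldDen_ne_zero _ _) (ldDen_ne_zero _ _)]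
  simp only [ldNum, ldDen, sumB, sigmaT, dOf_low2, low2_0, low2_1, low2_2, low2_3, low2_4, low2_5, low2_6, low2_7]
  -- peel the shifted factorials
  have p1 := facQ_succ hd
  have p2 := facQ_succ (z := b 2 - 1) (by omega)
  rw [show b 2 - 1 + 1 = b 2 by ring] at p2
  have p3 := facQ_succ (z := b 2 - 1 - m) (by omega)
  rw [show b 2 - 1 - m + 1 = b 2 - m by ring] at p3
  have q3 := facQ_succ h3
  rw [show b 0 - b 2 - b 3 + 1 = b 0 - (b 2 - 1) - b 3 by ring] at q3
  have q4 := facQ_succ h4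
  rw [show b 0 - b 2 - b 4 + 1 = b 0 - (b 2 - 1) - b 4 by ring] at q4
  have q5 := facQ_succ h5
  rw [show b 0 - b 2 - b 5 + 1 = b 0 - (b 2 - 1) - b 5 by ring] at q5
  have q6 := facQ_succ h6
  rw [show b 0 - b 2 - b 6 + 1 = b 0 - (b 2 - 1) - b 6 by ring] at q6
  have p4 := facQ_succ hσ
  rw [show b 0 + m - (b 1 + b 2 + b 7) + 1 = b 0 + m - (b 1 + (b 2 - 1) + b 7) by ring] at p4
  rw [p1, p2, p3, q3, q4, q5, q6, p4]
  push_cast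
  -- common linear factors as atoms keep the `ring` certificate small (buildfix: the expanded forms made lean abort on the plain build path)
  generalize ((b 0 : ℚ) - b 2 - b 3 + 1) = f3; generalize ((b 0 : ℚ) - b 2 - b 4 + 1) = f4; generalize ((b 0 : ℚ) - b 2 - b 5 + 1) = f5
  generalize ((b 0 : ℚ) - b 2 - b 6 + 1) = f6; generalize ((b 0 : ℚ) + m - (b 1 + b 2 + b 7) + 1) = f8
  ring

/-- Step lemma, slot 7 lowered. -/
theorem ldStep7 (b : ℕ → ℤ) (m : ℤ) (hb7 : 1 ≤ b 7) (hm : m + 1 ≤ b 7)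
    (h3 : 0 ≤ b 0 - b 7 - b 3) (h4 : 0 ≤ b 0 - b 7 - b 4) (h5 : 0 ≤ b 0 - b 7 - b 5) (h6 : 0 ≤ b 0 - b 7 - b 6)
    (hd : 0 ≤ dOf b) (hσ : 0 ≤ b 0 + m - (b 1 + b 2 + b 7)) :
    (b 7 : ℚ) * (((b 0 : ℚ) - b 7 - b 3 + 1) * ((b 0 : ℚ) - b 7 - b 4 + 1) * ((b 0 : ℚ) - b 7 - b 5 + 1) *
        ((b 0 : ℚ) - b 7 - b 6 + 1)) * ((b 0 : ℚ) + m - (b 1 + b 2 + b 7) + 1) *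
        ldWeightSym (Function.update b 7 (b 7 - 1)) m =
      ((dOf b : ℚ) + 1) * ((b 7 : ℚ) - m) * ldWeightSym b m := by
  rw [ldWeightSym_eq, ldWeightSym_eq, mul_div_assoc', mul_div_assoc',
    div_eq_div_iff (ldDen_ne_zero _ _) (ldDen_ne_zero _ _)]
  simp only [ldNum, ldDen, sumB, sigmaT, dOf_low7, low7_0, low7_1, low7_2, low7_3, low7_4, low7_5, low7_6, low7_7]
  have p1 := facQ_succ hd
  have p2 := facQ_succ (z := b 7 - 1) (by omega)
  rw [show b 7 - 1 + 1 = b 7 by ring] at p2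
  have p3 := facQ_succ (z := b 7 - 1 - m) (by omega)
  rw [show b 7 - 1 - m + 1 = b 7 - m by ring] at p3
  have q3 := facQ_succ h3
  rw [show b 0 - b 7 - b 3 + 1 = b 0 - (b 7 - 1) - b 3 by ring] at q3
  have q4 := facQ_succ h4
  rw [show b 0 - b 7 - b 4 + 1 = b 0 - (b 7 - 1) - b 4 by ring] at q4
  have q5 := facQ_succ h5
  rw [show b 0 - b 7 - b 5 + 1 = b 0 - (b 7 - 1) - b 5 by ring] at q5
  have q6 := facQ_succ h6
  rw [show b 0 - b 7 - b 6 + 1 = b 0 - (b 7 - 1) - b 6 by ring] at q6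
  have p4 := facQ_succ hσ
  rw [show b 0 + m - (b 1 + b 2 + b 7) + 1 = b 0 + m - (b 1 + b 2 + (b 7 - 1)) by ring] at p4
  rw [p1, p2, p3, q3, q4, q5, q6, p4]
  push_cast
  -- as in `ldStep2`: common linear factors as atoms
  generalize ((b 0 : ℚ) - b 7 - b 3 + 1) = f3; generalize ((b 0 : ℚ) - b 7 - b 4 + 1) = f4; generalize ((b 0 : ℚ) - b 7 - b 5 + 1) = f5
  generalize ((b 0 : ℚ) - b 7 - b 6 + 1) = f6; generalize ((b 0 : ℚ) + m - (b 1 + b 2 + b 7) + 1) = f8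
  ring

/-- Updating slots 2 and 7 commutes. -/
theorem upd_comm27 (b : ℕ → ℤ) :
    Function.update (Function.update b 7 (b 7 - 1)) 2 (b 2 - 1) =
      Function.update (Function.update b 2 (b 2 - 1)) 7 (b 7 - 1) :=
  (Function.update_comm (by decide) _ _ _).symm

/-- `ldStep7` at the shape `b − e₂` (expressed in `b`). -/
theorem ldStep7_at_low2 (b : ℕ → ℤ) (m : ℤ) (hb7 : 1 ≤ b 7) (hm : m + 1 ≤ b 7)
    (k3 : 0 ≤ b 0 - b 7 - b 3) (k4 : 0 ≤ b 0 - b 7 - b 4) (k5 : 0 ≤ b 0 - b 7 - b 5) (k6 : 0 ≤ b 0 - b 7 - b 6)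
    (hd : 0 ≤ dOf b) (hσ : 0 ≤ b 0 + m - (b 1 + b 2 + b 7) + 1) :
    (b 7 : ℚ) * (((b 0 : ℚ) - b 7 - b 3 + 1) * ((b 0 : ℚ) - b 7 - b 4 + 1) * ((b 0 : ℚ) - b 7 - b 5 + 1) * ((b 0 : ℚ) - b 7 - b 6 + 1)) * ((b 0 : ℚ) + m - (b 1 + b 2 + b 7) + 2) *
        ldWeightSym (Function.update (Function.update b 2 (b 2 - 1)) 7 (b 7 - 1)) m =
      ((dOf b : ℚ) + 2) * ((b 7 : ℚ) - m) * ldWeightSym (Function.update b 2 (b 2 - 1)) m := by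
  have h := ldStep7 (Function.update b 2 (b 2 - 1)) m (by rw [low2_7]; exact hb7) (by rw [low2_7]; exact hm)
    (by rw [low2_0, low2_7, low2_3]; exact k3) (by rw [low2_0, low2_7, low2_4]; exact k4)
    (by rw [low2_0, low2_7, low2_5]; exact k5) (by rw [low2_0, low2_7, low2_6]; exact k6)
    (by rw [dOf_low2]; omega) (by rw [low2_0, low2_1, low2_2, low2_7]; omega)
  simp only [low2_0, low2_1, low2_2, low2_3, low2_4, low2_5, low2_6, low2_7, dOf_low2] at h
  push_cast at h
  linear_combination h

/-- `ldStep2` at the shape `b − e₇` (expressed in `b`, double shape spelled `2` then `7`). -/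
theorem ldStep2_at_low7 (b : ℕ → ℤ) (m : ℤ) (hb2 : 1 ≤ b 2) (hm : m + 1 ≤ b 2)
    (h3 : 0 ≤ b 0 - b 2 - b 3) (h4 : 0 ≤ b 0 - b 2 - b 4) (h5 : 0 ≤ b 0 - b 2 - b 5) (h6 : 0 ≤ b 0 - b 2 - b 6)
    (hd : 0 ≤ dOf b) (hσ : 0 ≤ b 0 + m - (b 1 + b 2 + b 7) + 1) :
    (b 2 : ℚ) * (((b 0 : ℚ) - b 2 - b 3 + 1) * ((b 0 : ℚ) - b 2 - b 4 + 1) * ((b 0 : ℚ) - b 2 - b 5 + 1) * ((b 0 : ℚ) - b 2 - b 6 + 1)) * ((b 0 : ℚ) + m - (b 1 + b 2 + b 7) + 2) *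
        ldWeightSym (Function.update (Function.update b 2 (b 2 - 1)) 7 (b 7 - 1)) m =
      ((dOf b : ℚ) + 2) * ((b 2 : ℚ) - m) * ldWeightSym (Function.update b 7 (b 7 - 1)) m := by
  have h := ldStep2 (Function.update b 7 (b 7 - 1)) m (by rw [low7_2]; exact hb2) (by rw [low7_2]; exact hm)
    (by rw [low7_0, low7_2, low7_3]; exact h3) (by rw [low7_0, low7_2, low7_4]; exact h4)
    (by rw [low7_0, low7_2, low7_5]; exact h5) (by rw [low7_0, low7_2, low7_6]; exact h6)
    (by rw [dOf_low7]; omega) (by rw [low7_0, low7_1, low7_2, low7_7]; omega)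
  simp only [low7_0, low7_1, low7_2, low7_3, low7_4, low7_5, low7_6, low7_7, dOf_low7, upd_comm27] at h
  push_cast at h
  linear_combination h

set_option maxHeartbeats 800000 in
/-- (L3), the four cases with `m` in the support of `ldW b`. -/
theorem ldW_cross_of_supp (b : ℕ → ℤ) (m : ℤ) (_hN : 0 ≤ b 0)
    (hbox : ∀ j ∈ Icc 1 7, 0 ≤ b j ∧ b j ≤ b 0) (hB : ∀ j ∈ Icc 3 6, 2 * b j ≤ b 0) (hd : 0 ≤ dOf b)
    (hb2 : 1 ≤ b 2) (hb7 : 1 ≤ b 7) (h1 : ldSupp b m) :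
    ((b 2 : ℚ) - b 7) * ((dOf b : ℚ) + 1) * ldW b m =
      (b 2 : ℚ) * (∏ j ∈ ({1, 3, 4, 5, 6} : Finset ℕ), ((b 0 : ℚ) - b 2 - b j + 1)) * ldW (Function.update b 2 (b 2 - 1)) m -
        (b 7 : ℚ) * (∏ j ∈ ({1, 3, 4, 5, 6} : Finset ℕ), ((b 0 : ℚ) - b 7 - b j + 1)) * ldW (Function.update b 7 (b 7 - 1)) m := by
  simp only [mem_Icc] at hbox hB
  have hx1 := hbox 1 (by norm_num); have hx2 := hbox 2 (by norm_num); have hx3 := hbox 3 (by norm_num)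
  have hx4 := hbox 4 (by norm_num); have hx5 := hbox 5 (by norm_num); have hx6 := hbox 6 (by norm_num)
  have hx7 := hbox 7 (by norm_num)
  have hB3 := hB 3 (by norm_num); have hB4 := hB 4 (by norm_num); have hB5 := hB 5 (by norm_num)
  have hB6 := hB 6 (by norm_num)
  have hdq : (0 : ℚ) ≤ (dOf b : ℚ) := by exact_mod_cast hd
  simp only [ldW, prod_insert, mem_insert, mem_singleton, prod_singleton, Nat.reduceEqDiff, or_self,
    not_false_eq_true]
  by_cases h2 : ldSupp (Function.update b 2 (b 2 - 1)) m <;>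
    by_cases h3 : ldSupp (Function.update b 7 (b 7 - 1)) m <;>
    simp only [h1, h2, h3, if_true, if_false] <;>
    simp only [ldSupp, Icc_three_six, mem_insert, mem_singleton, forall_eq_or_imp, forall_eq, sigmaT,
      low2_0, low2_1, low2_2, low2_3, low2_4, low2_5, low2_6, low2_7, low7_0, low7_1, low7_2, low7_3, low7_4, low7_5, low7_6, low7_7] at h1 h2 h3
  · -- interior: all three terms present
    have s2 := ldStep2 b m hb2 (by omega) (by omega) (by omega) (by omega) (by omega) hd (by omega)
    have s7 := ldStep7 b m hb7 (by omega) (by omega) (by omega) (by omega) (by omega) hd (by omega)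
    have hne : ((b 0 : ℚ) + m - (b 1 + b 2 + b 7) + 1) ≠ 0 := by
      have : (0 : ℤ) < b 0 + m - (b 1 + b 2 + b 7) + 1 := by omega
      have : (0 : ℚ) < ((b 0 + m - (b 1 + b 2 + b 7) + 1 : ℤ) : ℚ) := by exact_mod_cast this
      push_cast at this
      exact this.ne'
    apply mul_left_cancel₀ hne
    -- the quartic factors are common atoms; generalising them keeps the `ring` certificates small (as in `ldStep2`)
    generalize ((b 0 : ℚ) - b 2 - b 3 + 1) = f23 at s2 ⊢; generalize ((b 0 : ℚ) - b 2 - b 4 + 1) = f24 at s2 ⊢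
    generalize ((b 0 : ℚ) - b 2 - b 5 + 1) = f25 at s2 ⊢; generalize ((b 0 : ℚ) - b 2 - b 6 + 1) = f26 at s2 ⊢
    generalize ((b 0 : ℚ) - b 7 - b 3 + 1) = f73 at s7 ⊢; generalize ((b 0 : ℚ) - b 7 - b 4 + 1) = f74 at s7 ⊢
    generalize ((b 0 : ℚ) - b 7 - b 5 + 1) = f75 at s7 ⊢; generalize ((b 0 : ℚ) - b 7 - b 6 + 1) = f76 at s7 ⊢
    linear_combination (-((b 0 : ℚ) - b 2 - b 1 + 1)) * s2 + ((b 0 : ℚ) - b 7 - b 1 + 1) * s7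
  · -- m = b₇: the slot-7 term is absent
    have s2 := ldStep2 b m hb2 (by omega) (by omega) (by omega) (by omega) (by omega) hd (by omega)
    obtain rfl : m = b 7 := by omega
    generalize ((b 0 : ℚ) - b 2 - b 3 + 1) = f23 at s2 ⊢; generalize ((b 0 : ℚ) - b 2 - b 4 + 1) = f24 at s2 ⊢
    generalize ((b 0 : ℚ) - b 2 - b 5 + 1) = f25 at s2 ⊢; generalize ((b 0 : ℚ) - b 2 - b 6 + 1) = f26 at s2 ⊢
    linear_combination -s2
  · -- m = b₂: the slot-2 term is absent
    have s7 := ldStep7 b m hb7 (by omega) (by omega) (by omega) (by omega) (by omega) hd (by omega)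
    obtain rfl : m = b 2 := by omega
    generalize ((b 0 : ℚ) - b 7 - b 3 + 1) = f73 at s7 ⊢; generalize ((b 0 : ℚ) - b 7 - b 4 + 1) = f74 at s7 ⊢
    generalize ((b 0 : ℚ) - b 7 - b 5 + 1) = f75 at s7 ⊢; generalize ((b 0 : ℚ) - b 7 - b 6 + 1) = f76 at s7 ⊢
    linear_combination s7
  · -- m = b₂ = b₇
    have h27 : ((b 2 : ℚ) - b 7) = 0 := by
      have : b 2 - b 7 = 0 := by omega
      exact_mod_cast this
    rw [h27]; ring

set_option maxHeartbeats 800000 in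
/-- (L3), the four cases with `m` outside the support of `ldW b`. -/
theorem ldW_cross_of_not_supp (b : ℕ → ℤ) (m : ℤ) (_hN : 0 ≤ b 0)
    (hbox : ∀ j ∈ Icc 1 7, 0 ≤ b j ∧ b j ≤ b 0) (hB : ∀ j ∈ Icc 3 6, 2 * b j ≤ b 0) (hd : 0 ≤ dOf b)
    (hb2 : 1 ≤ b 2) (hb7 : 1 ≤ b 7) (h1 : ¬ ldSupp b m) :
    ((b 2 : ℚ) - b 7) * ((dOf b : ℚ) + 1) * ldW b m =
      (b 2 : ℚ) * (∏ j ∈ ({1, 3, 4, 5, 6} : Finset ℕ), ((b 0 : ℚ) - b 2 - b j + 1)) * ldW (Function.update b 2 (b 2 - 1)) m -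
        (b 7 : ℚ) * (∏ j ∈ ({1, 3, 4, 5, 6} : Finset ℕ), ((b 0 : ℚ) - b 7 - b j + 1)) * ldW (Function.update b 7 (b 7 - 1)) m := by
  simp only [mem_Icc] at hbox hB
  have hx1 := hbox 1 (by norm_num); have hx2 := hbox 2 (by norm_num); have hx3 := hbox 3 (by norm_num)
  have hx4 := hbox 4 (by norm_num); have hx5 := hbox 5 (by norm_num); have hx6 := hbox 6 (by norm_num)
  have hx7 := hbox 7 (by norm_num)
  have hB3 := hB 3 (by norm_num); have hB4 := hB 4 (by norm_num); have hB5 := hB 5 (by norm_num)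
  have hB6 := hB 6 (by norm_num)
  have hdq : (0 : ℚ) ≤ (dOf b : ℚ) := by exact_mod_cast hd
  simp only [ldW, prod_insert, mem_insert, mem_singleton, prod_singleton, Nat.reduceEqDiff, or_self,
    not_false_eq_true]
  by_cases h2 : ldSupp (Function.update b 2 (b 2 - 1)) m <;>
    by_cases h3 : ldSupp (Function.update b 7 (b 7 - 1)) m <;>
    simp only [h1, h2, h3, if_true, if_false] <;>
    simp only [ldSupp, Icc_three_six, mem_insert, mem_singleton, forall_eq_or_imp, forall_eq, sigmaT,
      low2_0, low2_1, low2_2, low2_3, low2_4, low2_5, low2_6, low2_7, low7_0, low7_1, low7_2, low7_3, low7_4, low7_5, low7_6, low7_7] at h1 h2 h3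
  · -- lower edge m = σ − N − 1: only the two lowered terms
    have t7 := ldStep7_at_low2 b m hb7 (by omega) (by omega) (by omega) (by omega) (by omega) hd (by omega)
    have t2 := ldStep2_at_low7 b m hb2 (by omega) (by omega) (by omega) (by omega) (by omega) hd (by omega)
    obtain rfl : m = b 1 + b 2 + b 7 - b 0 - 1 := by omega
    push_cast at t7 t2 ⊢
    have hne : ((dOf b : ℚ) + 2) ≠ 0 := ne_of_gt (by linarith)
    apply mul_left_cancel₀ hne
    generalize ((b 0 : ℚ) - b 2 - b 3 + 1) = f23 at t2 ⊢; generalize ((b 0 : ℚ) - b 2 - b 4 + 1) = f24 at t2 ⊢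
    generalize ((b 0 : ℚ) - b 2 - b 5 + 1) = f25 at t2 ⊢; generalize ((b 0 : ℚ) - b 2 - b 6 + 1) = f26 at t2 ⊢
    generalize ((b 0 : ℚ) - b 7 - b 3 + 1) = f73 at t7 ⊢; generalize ((b 0 : ℚ) - b 7 - b 4 + 1) = f74 at t7 ⊢
    generalize ((b 0 : ℚ) - b 7 - b 5 + 1) = f75 at t7 ⊢; generalize ((b 0 : ℚ) - b 7 - b 6 + 1) = f76 at t7 ⊢
    linear_combination ((b 2 : ℚ) * (f23 * f24 * f25 * f26)) * t7 - ((b 7 : ℚ) * (f73 * f74 * f75 * f76)) * t2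
  · -- a factor of Π₂ vanishes
    have hz : b 0 - b 2 - b 1 + 1 = 0 ∨ b 0 - b 2 - b 3 + 1 = 0 ∨ b 0 - b 2 - b 4 + 1 = 0 ∨
        b 0 - b 2 - b 5 + 1 = 0 ∨ b 0 - b 2 - b 6 + 1 = 0 := by omega
    have hP : (b 0 - b 2 - b 1 + 1) * ((b 0 - b 2 - b 3 + 1) * ((b 0 - b 2 - b 4 + 1) *
        ((b 0 - b 2 - b 5 + 1) * (b 0 - b 2 - b 6 + 1)))) = 0 := by
      rcases hz with hz | hz | hz | hz | hz <;> simp [hz]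
    have hPq : ((b 0 : ℚ) - b 2 - b 1 + 1) * (((b 0 : ℚ) - b 2 - b 3 + 1) * (((b 0 : ℚ) - b 2 - b 4 + 1) *
        (((b 0 : ℚ) - b 2 - b 5 + 1) * ((b 0 : ℚ) - b 2 - b 6 + 1)))) = 0 := by
      exact_mod_cast hP
    linear_combination (-((b 2 : ℚ) * ldWeightSym (Function.update b 2 (b 2 - 1)) m)) * hPq
  · -- a factor of Π₇ vanishes
    have hz : b 0 - b 7 - b 1 + 1 = 0 ∨ b 0 - b 7 - b 3 + 1 = 0 ∨ b 0 - b 7 - b 4 + 1 = 0 ∨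
        b 0 - b 7 - b 5 + 1 = 0 ∨ b 0 - b 7 - b 6 + 1 = 0 := by omega
    have hP : (b 0 - b 7 - b 1 + 1) * ((b 0 - b 7 - b 3 + 1) * ((b 0 - b 7 - b 4 + 1) *
        ((b 0 - b 7 - b 5 + 1) * (b 0 - b 7 - b 6 + 1)))) = 0 := by
      rcases hz with hz | hz | hz | hz | hz <;> simp [hz]
    have hPq : ((b 0 : ℚ) - b 7 - b 1 + 1) * (((b 0 : ℚ) - b 7 - b 3 + 1) * (((b 0 : ℚ) - b 7 - b 4 + 1) *
        (((b 0 : ℚ) - b 7 - b 5 + 1) * ((b 0 : ℚ) - b 7 - b 6 + 1)))) = 0 := by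
      exact_mod_cast hP
    linear_combination ((b 7 : ℚ) * ldWeightSym (Function.update b 7 (b 7 - 1)) m) * hPq
  · ring

/-- **(L3) PROVED.** The truncated symmetric weights satisfy the cross-contiguity relation of the wedges termwise in `m`
(interior: the one-line ratio identity; edges: a term leaving the support meets a vanishing coefficient). -/
theorem ldW_cross : ldW_cross_stmt := by
  intro b m hN hbox hB hd hb2 hb7
  by_cases h1 : ldSupp b m
  · exact ldW_cross_of_supp b m hN hbox hB hd hb2 hb7 h1
  · exact ldW_cross_of_not_supp b m hN hbox hB hd hb2 hb7 h1

/-- `Icc 3 7 = {3,4,5,6,7}` (index bookkeeping). -/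
theorem Icc_three_seven : (Icc 3 7 : Finset ℕ) = {3, 4, 5, 6, 7} := by decide

/-- `facQ 0 = 1`. -/
theorem facQ_zero : facQ 0 = 1 := by simp [facQ]

set_option maxHeartbeats 800000 in
/-- **Two-term branch PROVED** (memo §5b): on the row `b₇ = 0` only `m = 0` survives and
`(d+1)·ldW b 0 = ∏_{j∉{2,7}}(c₂ⱼ+1)·ldW (b−e₂) 0`. -/
theorem ldW_twoTerm : ldW_twoTerm_stmt := by
  intro b hN hbox hB hd hb2 hb7
  simp only [mem_Icc] at hbox hB
  have hx1 := hbox 1 (by norm_num); have hx2 := hbox 2 (by norm_num); have hx3 := hbox 3 (by norm_num)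
  have hx4 := hbox 4 (by norm_num); have hx5 := hbox 5 (by norm_num); have hx6 := hbox 6 (by norm_num)
  have hB3 := hB 3 (by norm_num); have hB4 := hB 4 (by norm_num); have hB5 := hB 5 (by norm_num)
  have hB6 := hB 6 (by norm_num)
  simp only [ldW, prod_insert, mem_insert, mem_singleton, prod_singleton, Nat.reduceEqDiff, or_self,
    not_false_eq_true]
  by_cases h1 : ldSupp b 0 <;> by_cases h2 : ldSupp (Function.update b 2 (b 2 - 1)) 0 <;>
    simp only [h1, h2, if_true, if_false] <;>
    simp only [ldSupp, Icc_three_six, mem_insert, mem_singleton, forall_eq_or_imp, forall_eq, sigmaT,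
      low2_0, low2_1, low2_2, low2_3, low2_4, low2_5, low2_6, low2_7] at h1 h2
  · have s2 := ldStep2 b 0 hb2 (by omega) (by omega) (by omega) (by omega) (by omega) hd (by omega)
    rw [hb7] at s2
    push_cast at s2
    have hb2q : (b 2 : ℚ) ≠ 0 := by exact_mod_cast (by omega : b 2 ≠ 0)
    apply mul_left_cancel₀ hb2q
    linear_combination -s2
  · exfalso; omega
  · have hz : b 0 - b 2 - b 1 + 1 = 0 ∨ b 0 - b 2 - b 3 + 1 = 0 ∨ b 0 - b 2 - b 4 + 1 = 0 ∨
        b 0 - b 2 - b 5 + 1 = 0 ∨ b 0 - b 2 - b 6 + 1 = 0 := by omega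
    have hP : (b 0 - b 2 - b 1 + 1) * ((b 0 - b 2 - b 3 + 1) * ((b 0 - b 2 - b 4 + 1) *
        ((b 0 - b 2 - b 5 + 1) * (b 0 - b 2 - b 6 + 1)))) = 0 := by
      rcases hz with hz | hz | hz | hz | hz <;> simp [hz]
    have hPq : ((b 0 : ℚ) - b 2 - b 1 + 1) * (((b 0 : ℚ) - b 2 - b 3 + 1) * (((b 0 : ℚ) - b 2 - b 4 + 1) *
        (((b 0 : ℚ) - b 2 - b 5 + 1) * ((b 0 : ℚ) - b 2 - b 6 + 1)))) = 0 := by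
      exact_mod_cast hP
    linear_combination (-(ldWeightSym (Function.update b 2 (b 2 - 1)) 0)) * hPq
  · ring

/-- The denominator of the face value never vanishes. -/
theorem faceDen_ne_zero (b : ℕ → ℤ) :
    (∏ j ∈ Icc 3 7, (facQ (b 0 - b 1 - b j) * facQ (b 0 - b 2 - b j))) ≠ 0 := by
  rw [Icc_three_seven]
  simp [prod_insert, facQ, Nat.factorial_ne_zero]

set_option maxHeartbeats 800000 in
/-- **Face weight PROVED** (L4, weight side): on `b₁ + b₂ = N` the truncated weight is the single term `m = b₇` with value `faceValue b`. -/
theorem ldW_face : ldW_face_stmt := by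
  intro b m hN hbox hd hface
  simp only [mem_Icc] at hbox
  have hx1 := hbox 1 (by norm_num); have hx2 := hbox 2 (by norm_num); have hx3 := hbox 3 (by norm_num)
  have hx4 := hbox 4 (by norm_num); have hx5 := hbox 5 (by norm_num); have hx6 := hbox 6 (by norm_num)
  have hx7 := hbox 7 (by norm_num)
  simp only [ldW]
  by_cases hS : ldSupp b m
  · have hS' := hS
    simp only [ldSupp, Icc_three_six, mem_insert, mem_singleton, forall_eq_or_imp, forall_eq, sigmaT] at hS'
    obtain rfl : m = b 7 := by omega
    rw [if_pos hS, if_pos ⟨rfl, hS⟩, ldWeightSym_eq, faceValue,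
      div_eq_div_iff (ldDen_ne_zero _ _) (faceDen_ne_zero _)]
    simp only [ldNum, ldDen, sumB, sigmaT, Icc_three_seven]
    simp only [prod_insert, mem_insert, mem_singleton, prod_singleton, Nat.reduceEqDiff, or_self,
      not_false_eq_true]
    -- align the factorial arguments using b₁ + b₂ = N
    rw [show b 7 - b 7 = 0 by ring, show b 0 + b 7 - (b 1 + b 2 + b 7) = 0 by omega, facQ_zero,
      show b 1 - b 7 = b 0 - b 2 - b 7 by omega, show b 2 - b 7 = b 0 - b 1 - b 7 by omega,
      show 2 * b 0 - (b 3 + b 4 + b 5 + b 6) - b 7 = dOf b by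
        simp only [dOf, sum_range_succ, sum_range_zero, Nat.reduceAdd]; omega,
      show b 0 - b 7 - b 3 = b 0 - b 3 - b 7 by ring, show b 0 - b 7 - b 4 = b 0 - b 4 - b 7 by ring,
      show b 0 - b 7 - b 5 = b 0 - b 5 - b 7 by ring, show b 0 - b 7 - b 6 = b 0 - b 6 - b 7 by ring,
      show (b 7 + (b 3 + b 4 + b 5 + b 6) : ℤ) = b 3 + b 4 + b 5 + b 6 + b 7 by ring]
    ring
  · rw [if_neg hS, if_neg]
    rintro ⟨rfl, h⟩
    exact hS h


end Summit.KontsevichZagierPeriods.Zeta5Search.WedgeDictionary
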